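import Summits.ResolutionOfSingularities.ResolutionOfSingularities.Theorems.WildConesCampaignW46HypersurfacesCharTwoHilbertWitness
import Mathlib.RingTheory.Nakayama

/-!
# [OURS · L1 W4.6, rung (ii) at p = 2, EVERY dimension n] THE `D₄` CLASS: a double point with `e = 2` and
# three distinct tangents (`h₂ = 1`) is ISOLATED with Milnor number EXACTLY `4`; conversely an isolated
# `e = 2` double point with `μ ≤ 4` has `h₂ = 1` (hypersurface double points `z² = a(u₁,…,uₙ)`, every
# field of characteristic 2)

HONEST FRAMING. Everything here is OURS: theorems about route WildCones' own TYPED point-blow-up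
dynamics (`Theorems/WildConesClassicalRegimesDefs.lean`) with the invariants `milnorEmbDim = e` (p498937)
and `milnorHilbertTwo = h₂` (p511581). Nothing here is a statement of H. Hironaka's manuscript
[Hironaka2017] and nothing of it is used; no FACT-LIST premise. AI review is weaker than expert review.
Cell res-hironaka (LADDER-RESOLUTION rung L, D-0089), slot W4.6, seat res-L1-s46-pv-4 (gen 4); host route
`WildCones`, crux `ClassicalRegimes` (stmt-ResolutionOfSingularities-16884, proved); `--supports … --as helper`.

WHAT IS HERE. `…TangentCone.lean` (p513980) showed that a double state with `e = 2`, `h₂ = 1` has only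
`e = 0`, `μ = 1` double successors, without assuming the state isolated. Here the state itself:
* `maximalIdeal_cube_le_jac_of_jetThreeColength_le_four` — two variables, no `xy`-term, order `≥ 2`,
  `jetThreeColength ≤ 4`: then `𝔪³ ≤ (∂a)`. Dimension count: `(∂a) + 𝔪³` sits inside the "diagonal"
  ideal `(x², y²) + 𝔪³` of colength `≥ 4` (`six_le_finrank_quot_add_card`) and has colength `≤ 4`, so
  they are equal and `x², y² ∈ (∂a) + 𝔪³`; hence `𝔪³ ≤ (∂a) + 𝔪⁴` and NAKAYAMA
  (`Submodule.le_of_le_smul_of_le_jacobson_bot`) gives `𝔪³ ≤ (∂a)`.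
* `finite_and_finrank_eq_four_of_jetThreeColength_le_four` — every `n`: `ord f ≥ 2`, `jetTwoColength f = 3`,
  `jetThreeColength f ≤ 4` ⇒ the Milnor algebra is FINITE of dimension `4` (residual descent).
* `hypersurface_isol_and_mu_eq_four_of_milnorHilbertTwo_eq_one`, `hypersurface_milnorHilbertTwo_eq_one_iff` —
  STATES: `e(c) = 2 ∧ h₂(c) = 1 ⇒ Isol c ∧ μ(c) = 4`; and for `e(c) = 2`:
  **`h₂(c) = 1 ⇔ (Isol c ∧ μ(c) = 4)`** — the three-tangents class IS the class of isolated corank-two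
  double points of Milnor number four (`D₄`); with p513980 each of its double successors has `μ = 1`.

References: G.-M. Greuel, G. Pfister [GreuelPfister2026] (through the tree's `exists_residual`); H. Hironaka,
ms. 2017-03-23 [Hironaka2017] — ROLE only, under adjudication, never as fact.
-/

noncomputable section

-- single-problem summit: the doubled namespace component `ResolutionOfSingularities` is forced
set_option linter.dupNamespace false

open scoped BigOperators Classical

open MvPowerSeries IsLocalRing

open Literature.AlgebraicGeometry.Resolution

namespace Summit.ResolutionOfSingularities.ResolutionOfSingularities.Theorems

namespace CampaignW46.HypersurfacesCharTwo

open WildCones WildCones.MuDropCharTwoOrdP ThreefoldsCharTwo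

variable {κ : Type} [Field κ]

/-! ## Two variables: `jetThreeColength ≤ 4` forces `𝔪³ ≤ (∂a)` -/

section TwoVariables

variable {i j : Fin 2}

/-- Two variables `{i, j}`, characteristic two: for `a` of order `≥ 2` without `X_iX_j`-term, both squares
`X_i²`, `X_j²` lie in `(∂a) + 𝔪³` as soon as `jetThreeColength a ≤ 4` (dimension count against the
diagonal ideal `(X_i², X_j²) + 𝔪³`). [folklore] -/
theorem sq_mem_jac_sup_cube_of_jetThreeColength_le_four [CharP κ 2] (hij : j ≠ i)
    {a : MvPowerSeries (Fin 2) κ} (ha : 2 ≤ a.order)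
    (hnopair : ∀ s t : Fin 2, s ≠ t → coeff (Finsupp.single s 1 + Finsupp.single t 1) a = 0)
    (h4 : jetThreeColength a ≤ 4) (s : Fin 2) :
    (X s : MvPowerSeries (Fin 2) κ) ^ 2 ∈ Ideal.span (Set.range fun t => MvPowerSeries.pderiv t a) ⊔
      maximalIdeal (MvPowerSeries (Fin 2) κ) ^ 3 := by
  have ha' := (FormalCoordChange.two_le_order_iff a).mp ha
  have hmem : ∀ t, MvPowerSeries.pderiv t a ∈ maximalIdeal (MvPowerSeries (Fin 2) κ) ^ 2 :=
    pderiv_mem_maximalIdeal_sq ha'.2 hnopair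
  set K := Ideal.span (Set.range fun t => MvPowerSeries.pderiv t a) ⊔
    maximalIdeal (MvPowerSeries (Fin 2) κ) ^ 3 with hK
  set T : Finset (MvPowerSeries (Fin 2) κ) := {X i ^ 2, X j ^ 2} with hT
  set V := Ideal.span (T : Set (MvPowerSeries (Fin 2) κ)) ⊔ maximalIdeal (MvPowerSeries (Fin 2) κ) ^ 3
    with hV
  have hsq : ∀ t : Fin 2, (X t : MvPowerSeries (Fin 2) κ) ^ 2 ∈
      maximalIdeal (MvPowerSeries (Fin 2) κ) ^ 2 := fun t =>
    Ideal.pow_mem_pow (X_mem_maximalIdeal κ (Fin 2) t) 2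
  have hTsub : (T : Set (MvPowerSeries (Fin 2) κ)) ⊆ (maximalIdeal (MvPowerSeries (Fin 2) κ) ^ 2 :
      Ideal (MvPowerSeries (Fin 2) κ)) := by
    intro x hx
    rw [hT, Finset.coe_insert, Finset.coe_singleton, Set.mem_insert_iff, Set.mem_singleton_iff] at hx
    rcases hx with rfl | rfl
    · exact hsq i
    · exact hsq j
  have hXiV : (X i : MvPowerSeries (Fin 2) κ) ^ 2 ∈ V :=
    Ideal.mem_sup_left (Ideal.subset_span (by simp [hT]))
  have hXjV : (X j : MvPowerSeries (Fin 2) κ) ^ 2 ∈ V :=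
    Ideal.mem_sup_left (Ideal.subset_span (by simp [hT]))
  -- `K ≤ V`: each partial is its diagonal quadratic part plus an element of `𝔪³`
  have hKV : K ≤ V := by
    refine sup_le ?_ le_sup_right
    rw [Ideal.span_le]
    rintro _ ⟨t, rfl⟩
    have hr := sub_quadPart_mem_cube hij (hmem t)
    rw [coeff_pair_pderiv_eq_zero hij t a, map_zero, zero_mul, add_zero] at hr
    have hdec : MvPowerSeries.pderiv t a =
        (C (coeff (Finsupp.single i 2) (MvPowerSeries.pderiv t a)) * X i ^ 2 +
          C (coeff (Finsupp.single j 2) (MvPowerSeries.pderiv t a)) * X j ^ 2) +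
        (MvPowerSeries.pderiv t a - (C (coeff (Finsupp.single i 2) (MvPowerSeries.pderiv t a)) * X i ^ 2 +
          C (coeff (Finsupp.single j 2) (MvPowerSeries.pderiv t a)) * X j ^ 2)) := by ring
    change MvPowerSeries.pderiv t a ∈ V
    rw [hdec]
    exact Ideal.add_mem _ (Ideal.add_mem _ (Ideal.mul_mem_left _ _ hXiV) (Ideal.mul_mem_left _ _ hXjV))
      (Ideal.mem_sup_right hr)
  -- colengths: `dim R/V ≥ 4 ≥ dim R/K`, so `K = V`
  have h6 := six_le_finrank_quot_add_card T hTsub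
  have hcard : T.card ≤ 2 := by rw [hT]; exact Finset.card_le_two
  haveI := finite_quot_span_pderiv_sup_pow a 3
  have h4' : Module.finrank κ (MvPowerSeries (Fin 2) κ ⧸ K) ≤ 4 := h4
  have h6' : 6 ≤ Module.finrank κ (MvPowerSeries (Fin 2) κ ⧸ V) + T.card := h6
  have hKV' : K = V := by
    by_contra hne
    have hlt : K < V := lt_of_le_of_ne hKV hne
    have := Literature.RingTheory.Length.finrank_quotient_lt_of_lt (κ := κ) hlt
    omega
  rcases finTwo_eq_or hij s with rfl | rfl
  · rw [hKV']; exact hXiV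
  · rw [hKV']; exact hXjV

/-- [OURS · L1 W4.6] **`𝔪³ ≤ (∂a)` IN THE `D₄` CLASS** (two variables, characteristic two): for `a` of order
`≥ 2` without `xy`-term and `jetThreeColength a ≤ 4`, the gradient ideal contains `𝔪³`. From
`x², y² ∈ (∂a) + 𝔪³`: `𝔪³ ≤ (∂a) + 𝔪⁴ = (∂a) + 𝔪·𝔪³`, and Nakayama. [folklore] -/
theorem maximalIdeal_cube_le_jac_of_jetThreeColength_le_four [CharP κ 2] (hij : j ≠ i)
    {a : MvPowerSeries (Fin 2) κ} (ha : 2 ≤ a.order)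
    (hnopair : ∀ s t : Fin 2, s ≠ t → coeff (Finsupp.single s 1 + Finsupp.single t 1) a = 0)
    (h4 : jetThreeColength a ≤ 4) :
    maximalIdeal (MvPowerSeries (Fin 2) κ) ^ 3 ≤ Ideal.span (Set.range fun t => MvPowerSeries.pderiv t a) := by
  set J := Ideal.span (Set.range fun t => MvPowerSeries.pderiv t a) with hJ
  set m := maximalIdeal (MvPowerSeries (Fin 2) κ) with hm
  have hsq := sq_mem_jac_sup_cube_of_jetThreeColength_le_four hij ha hnopair h4
  -- `𝔪³ ≤ J + 𝔪⁴`
  have h34 : m ^ 3 ≤ J ⊔ m * m ^ 3 := by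
    conv_lhs => rw [hm, Literature.RingTheory.MvPowerSeries.Jets.maximalIdeal_pow_eq_span_monomial 3]
    rw [Ideal.span_le]
    rintro _ ⟨e, he, rfl⟩
    change e.degree = 3 at he
    rw [finTwo_degree hij] at he
    -- a degree-3 monomial is (degree-1 monomial) · X_s² for some `s`
    have key : ∀ s : Fin 2, 2 ≤ e s → (monomial e (1 : κ) : MvPowerSeries (Fin 2) κ) ∈
        (Ideal.span (Set.range fun t => MvPowerSeries.pderiv t a) ⊔
          maximalIdeal (MvPowerSeries (Fin 2) κ) * maximalIdeal (MvPowerSeries (Fin 2) κ) ^ 3 :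
            Ideal (MvPowerSeries (Fin 2) κ)) := by
      intro s hs
      have hdec : (monomial e (1 : κ) : MvPowerSeries (Fin 2) κ) =
          monomial (e - Finsupp.single s 2) (1 : κ) * X s ^ 2 := by
        rw [X_pow_eq, monomial_mul_monomial, one_mul, tsub_add_cancel_of_le]
        intro t
        by_cases hts : t = s
        · subst hts; rwa [Finsupp.single_eq_same]
        · rw [Finsupp.single_apply, if_neg (Ne.symm hts)]; exact Nat.zero_le _
      have hlin : (monomial (e - Finsupp.single s 2) (1 : κ) : MvPowerSeries (Fin 2) κ) ∈
          maximalIdeal (MvPowerSeries (Fin 2) κ) := by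
        have h1 := Literature.RingTheory.MvPowerSeries.Jets.monomial_mem_maximalIdeal_pow
          (σ := Fin 2) (e := e - Finsupp.single s 2) (N := 1) (by
            rw [finTwo_degree hij]
            simp only [Finsupp.coe_tsub, Pi.sub_apply]
            rcases finTwo_eq_or hij s with rfl | rfl
            · rw [Finsupp.single_eq_same, Finsupp.single_eq_of_ne hij]; omega
            · rw [Finsupp.single_eq_same, Finsupp.single_eq_of_ne hij.symm]; omega) (1 : κ)
        rwa [pow_one] at h1
      rw [hdec]
      -- `lin · X_s² ∈ 𝔪 · (J + 𝔪³) ≤ J + 𝔪·𝔪³`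
      have hprod : (monomial (e - Finsupp.single s 2) (1 : κ) : MvPowerSeries (Fin 2) κ) * X s ^ 2 ∈
          maximalIdeal (MvPowerSeries (Fin 2) κ) *
            (Ideal.span (Set.range fun t => MvPowerSeries.pderiv t a) ⊔
              maximalIdeal (MvPowerSeries (Fin 2) κ) ^ 3) := Ideal.mul_mem_mul hlin (hsq s)
      rw [Ideal.mul_sup] at hprod
      have hle : maximalIdeal (MvPowerSeries (Fin 2) κ) *
            Ideal.span (Set.range fun t => MvPowerSeries.pderiv t a) ⊔
          maximalIdeal (MvPowerSeries (Fin 2) κ) * maximalIdeal (MvPowerSeries (Fin 2) κ) ^ 3 ≤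
          Ideal.span (Set.range fun t => MvPowerSeries.pderiv t a) ⊔
            maximalIdeal (MvPowerSeries (Fin 2) κ) * maximalIdeal (MvPowerSeries (Fin 2) κ) ^ 3 :=
        sup_le_sup_right Ideal.mul_le_left _
      exact hle hprod
    change (monomial e (1 : κ) : MvPowerSeries (Fin 2) κ) ∈ J ⊔ m * m ^ 3
    by_cases h0 : 2 ≤ e i
    · exact key i h0
    · exact key j (by omega)
  -- Nakayama
  have hfg : (m ^ 3).FG := by
    have hmfg : m.FG := by
      rw [hm, maximalIdeal_mvPowerSeries_eq_span]
      exact Submodule.fg_span (Set.finite_range _)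
    exact hmfg.pow
  have hjac : m ≤ Ideal.jacobson ⊥ := IsLocalRing.maximalIdeal_le_jacobson ⊥
  refine Submodule.le_of_le_smul_of_le_jacobson_bot hfg hjac ?_
  rw [Ideal.smul_eq_mul]
  exact h34

end TwoVariables

/-! ## Every `n`: finite Milnor algebra of dimension four -/

/-- [OURS · L1 W4.6] **`e = 2`, `h₂ = 1` ⇒ FINITE MILNOR ALGEBRA OF DIMENSION `4`** (characteristic two,
every `n`): for `f` of order `≥ 2` with `jetTwoColength f = 3` and `jetThreeColength f ≤ 4`, the Milnor
algebra `κ⟦X⟧/(∂f)` is finite of dimension exactly `4`. Residual descent to two variables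
(`exists_residual`) and `maximalIdeal_cube_le_jac_of_jetThreeColength_le_four`.
[cite: GreuelPfister2026, Thm 3.5 and Cor 3.7] -/
theorem finite_and_finrank_eq_four_of_jetThreeColength_le_four [CharP κ 2] {n : ℕ}
    {f : MvPowerSeries (Fin n) κ} (hf : 2 ≤ f.order) (h3 : jetTwoColength f = 3)
    (h4 : jetThreeColength f ≤ 4) :
    Module.Finite κ (MvPowerSeries (Fin n) κ ⧸ Ideal.span (Set.range fun s => MvPowerSeries.pderiv s f)) ∧
      Module.finrank κ (MvPowerSeries (Fin n) κ ⧸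
        Ideal.span (Set.range fun s => MvPowerSeries.pderiv s f)) = 4 := by
  obtain ⟨m, g, -, -, hg, hnp, ⟨ε⟩, -⟩ := exists_residual n f hf
  have hm : m = 2 := by
    have := jetTwoColength_eq_of_residual hg hnp ε
    omega
  subst hm
  have h4g : jetThreeColength g ≤ 4 := by rw [← jetThreeColength_eq_of_equiv ε]; exact h4
  have hcube := maximalIdeal_cube_le_jac_of_jetThreeColength_le_four (show (1 : Fin 2) ≠ 0 by decide)
    hg hnp h4g
  have hsup : Ideal.span (Set.range fun t => MvPowerSeries.pderiv t g) ⊔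
      maximalIdeal (MvPowerSeries (Fin 2) κ) ^ 3 =
        Ideal.span (Set.range fun t => MvPowerSeries.pderiv t g) := sup_eq_left.mpr hcube
  haveI hfin : Module.Finite κ (MvPowerSeries (Fin 2) κ ⧸
      Ideal.span (Set.range fun t => MvPowerSeries.pderiv t g)) :=
    finite_quot_mono hcube (Literature.RingTheory.MvPowerSeries.Jets.finite_quotient_maximalIdeal_pow 3)
  have hval : Module.finrank κ (MvPowerSeries (Fin 2) κ ⧸
      Ideal.span (Set.range fun t => MvPowerSeries.pderiv t g)) = 4 := by
    have hle := four_le_jetThreeColength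
      (pderiv_mem_maximalIdeal_sq ((FormalCoordChange.two_le_order_iff _).mp hg).2 hnp)
    unfold jetThreeColength at hle h4g
    rw [hsup] at hle h4g
    omega
  exact ⟨Module.Finite.equiv ε.symm.toLinearEquiv, by rw [ε.toLinearEquiv.finrank_eq, hval]⟩

/-! ## States: the `D₄` class -/

section States

variable {n : ℕ}

/-- [OURS · L1 W4.6 rung (ii) at `p = 2`, every dimension; NOT a statement of the manuscript] **A DOUBLE
STATE WITH `e = 2` AND THREE DISTINCT TANGENTS (`h₂ = 1`) IS ISOLATED WITH MILNOR NUMBER EXACTLY `4`**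
(hypersurface double points `z² = a(u₁,…,uₙ)`, any field of characteristic `2`, any `n`). With
p513980 (`hypersurface_regime_step_of_milnorHilbertTwo_eq_one`) each of its double successors has `μ = 1`:
the Milnor number drops by three. [cite: GreuelPfister2026, Thm 3.5 and Cor 3.7] -/
theorem hypersurface_isol_and_mu_eq_four_of_milnorHilbertTwo_eq_one [CharP κ 2] (c : (Fin n → ℕ) → κ)
    (hM : MultP 2 n κ c) (he : milnorEmbDim 2 n κ c = 2) (hh : milnorHilbertTwo 2 n κ c = 1) :
    Isol 2 n κ c ∧ mu 2 n κ c = 4 := by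
  have hcol := (milnorEmbDim_le_and_mod_two hM).2.2
  have hr := milnorHilbertTwo_range hM he
  obtain ⟨hfin, h4⟩ := finite_and_finrank_eq_four_of_jetThreeColength_le_four (two_le_order_ser hM)
    (by rw [hcol, he]) (by rw [hr.2.2, hh])
  rw [isol_iff_finite_pderiv, mu_eq_finrank_pderiv]
  exact ⟨hfin, h4⟩

/-- [OURS · L1 W4.6 rung (ii) at `p = 2`, every dimension; NOT a statement of the manuscript] **THE `D₄`
CLASS CHARACTERISED**: for a double state of `z² = a(u₁,…,uₙ)` (any field of characteristic `2`) with
`e(c) = 2` (polar form of corank two): `h₂(c) = 1` (three distinct tangents of the residual plane cubic)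
**iff** `c` is isolated with `μ(c) = 4`. (`⇒`: this file; `⇐`: `h₂ + e + 1 ≤ μ`,
`milnorHilbertTwo_eq_one_of_mu_le_four`.) [folklore] -/
theorem hypersurface_milnorHilbertTwo_eq_one_iff [CharP κ 2] (c : (Fin n → ℕ) → κ)
    (hM : MultP 2 n κ c) (he : milnorEmbDim 2 n κ c = 2) :
    milnorHilbertTwo 2 n κ c = 1 ↔ Isol 2 n κ c ∧ mu 2 n κ c = 4 := by
  constructor
  · exact hypersurface_isol_and_mu_eq_four_of_milnorHilbertTwo_eq_one c hM he
  · rintro ⟨hI, hμ⟩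
    exact (milnorHilbertTwo_eq_one_of_mu_le_four hM hI he hμ.le).1

/-- [OURS · L1 W4.6 rung (ii) at `p = 2`, every dimension; NOT a statement of the manuscript] In the
`D₄` class the Milnor number drops by EXACTLY THREE at every double successor (`4 ↦ 1`). [folklore] -/
theorem hypersurface_mu_step_add_three_of_milnorHilbertTwo_eq_one [CharP κ 2] (c : (Fin n → ℕ) → κ)
    (i : Fin n) (τ : Fin n → κ) (hM : MultP 2 n κ c) (he : milnorEmbDim 2 n κ c = 2)
    (hh : milnorHilbertTwo 2 n κ c = 1) (hM' : MultP 2 n κ (step 2 n κ i τ c)) :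
    mu 2 n κ (step 2 n κ i τ c) + 3 = mu 2 n κ c := by
  rw [(hypersurface_isol_and_mu_eq_four_of_milnorHilbertTwo_eq_one c hM he hh).2,
    (hypersurface_regime_step_of_milnorHilbertTwo_eq_one c i τ hM he hh hM').2.2]

end States

end CampaignW46.HypersurfacesCharTwo

end Summit.ResolutionOfSingularities.ResolutionOfSingularities.Theorems

end
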